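import Summits.ResolutionOfSingularities.ResolutionOfSingularities.Theorems.FrobeniusLadderFInjectiveMacaulayficationTwoLevelRoadFrame
import Summits.ResolutionOfSingularities.ResolutionOfSingularities.Theorems.FrobeniusLadderFInjectiveMacaulayficationTranslatedRelativeCN
import HarnessLib

/-!
# E7 — moving a LEVEL-2 certificate block from the translated model `k[u]/(f̃)` to the chart model `k[y]/(g)`, `g = σ f̃`
# (crux `FInjectiveMacaulayfication` stmt-ResolutionOfSingularities-15315, chain w45a; E7 T₁₁/3, LEVEL-2 BINDER SHAPE, STATUS 2026-08-27T13:01:47Z)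

[OURS · L1 W4.5a · res-L1-w45a-lead-1 gen 5] Support file (`--supports stmt-ResolutionOfSingularities-15315 --as helper`); NOT a statement of
any manuscript; AI-written, weaker than expert review.

The level-2 input `hblock σ` of `TwoLevelRoadFrame.pointFixable_of_chartModels₂` is a certificate block (COV) ∧ (NZ) ∧ (HON) for the
curve's model ideal `I₂ σ ⊂ B σ = k[y]/(g_σ)`. The producer `CICertificates.ciCertificates` delivers such a block on the TRANSLATED model
`k[u]/(f̃)` (`Fs = ![f̃]`, base ideal `Ideal.span (Set.range ![f̃])`), where the curve is the coordinate line `V(u_J)` and the centre is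
monomial (`I_A`, `A` from `LineBlowupFan4`). `block_of_translated` moves it along the translation `σ` (`σ f̃ = g`; res-type-034's N3
`TranslatedRelativeCN.exists_quotientEquiv_of_ringEquiv`) composed with the two `Ideal.quotEquivOfEq` (range-singleton / `σ f̃ = g`), by
`CertifiedCoverCongr.cert_congr` and `TwoLevelRoadFrame.block_of_eq`; the target ideal is `span {mk (σ u^b) : b ∈ A}` (for a translation
`u_r ↦ y_r + c` and `A ∋ e_j`: the ideal `(y_j (+ c))_{j ∈ J}` of the curve in the chart). No definitions. [folklore]
-/

-- single-problem summit: the doubled namespace component is forced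
set_option linter.dupNamespace false

noncomputable section

namespace Summit.ResolutionOfSingularities.ResolutionOfSingularities.Theorems.FInjectiveMacaulayfication.LevelTwoBlockTranslate

open Literature.AlgebraicGeometry.Resolution MvPolynomial
open Summit.ResolutionOfSingularities.ResolutionOfSingularities.Theorems.FInjectiveMacaulayfication

/-- `Set.range ![f] = {f}`. [folklore] -/
theorem range_vec_one {α : Type} (f : α) : Set.range (![f] : Fin 1 → α) = {f} := by
  ext x
  simp only [Set.mem_range, Set.mem_singleton_iff, Matrix.cons_val_fin_one, exists_const]
  exact eq_comm

/-- **The translated quotient isomorphism, from the `Fin 1`-range base ideal**: for a ring automorphism `σ` of `k[y]` and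
`σ f̃ = g`, an isomorphism `k[y]/(Set.range ![f̃]) ≃+* k[y]/(g)` with `mk x ↦ mk (σ x)`. [folklore] -/
theorem exists_quotientEquiv_range_of_ringEquiv {k : Type} [Field k] {n : ℕ}
    (σ : MvPolynomial (Fin n) k ≃+* MvPolynomial (Fin n) k) (f g : MvPolynomial (Fin n) k) (hg : σ f = g) :
    ∃ ε : (MvPolynomial (Fin n) k ⧸ Ideal.span (Set.range (![f] : Fin 1 → MvPolynomial (Fin n) k))) ≃+*
        (MvPolynomial (Fin n) k ⧸ Ideal.span {g}),
      ∀ x, ε (Ideal.Quotient.mk (Ideal.span (Set.range (![f] : Fin 1 → MvPolynomial (Fin n) k))) x) =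
        Ideal.Quotient.mk (Ideal.span {g}) (σ x) := by
  have h1 : Ideal.span (Set.range (![f] : Fin 1 → MvPolynomial (Fin n) k)) = Ideal.span {f} := by rw [range_vec_one]
  have h3 : Ideal.span {σ f} = Ideal.span {g} := by rw [hg]
  obtain ⟨ε₂, hε₂⟩ := TranslatedRelativeCN.exists_quotientEquiv_of_ringEquiv σ f
  refine ⟨(Ideal.quotEquivOfEq h1).trans (ε₂.trans (Ideal.quotEquivOfEq h3)), fun x => ?_⟩
  rw [RingEquiv.trans_apply, Ideal.quotEquivOfEq_mk, RingEquiv.trans_apply, hε₂, Ideal.quotEquivOfEq_mk]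

/-- **A LEVEL-2 BLOCK MOVES FROM THE TRANSLATED MODEL TO THE CHART MODEL.** A certificate block (COV) ∧ (NZ) ∧ (HON) for
`(k[u]/(Set.range ![f̃]), I_A)` (`CICertificates.ciCertificates` output shape, packed as `CertifiedCoverCongr.cert_congr`'s `h`) gives
one for `(k[y]/(g), span {mk (σ u^b) : b ∈ A})` whenever `σ f̃ = g`. [folklore] -/
theorem block_of_translated (p : ℕ) {k : Type} [Field k] {n : ℕ}
    (σ : MvPolynomial (Fin n) k ≃+* MvPolynomial (Fin n) k) (f g : MvPolynomial (Fin n) k) (hg : σ f = g)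
    (A : Finset (Fin n →₀ ℕ))
    (h : ∃ (t : ℕ) (v : Fin t → MvPolynomial (Fin n) k ⧸ Ideal.span (Set.range (![f] : Fin 1 → MvPolynomial (Fin n) k)))
        (hv : ∀ j : Fin t, v j ∈ Ideal.span ((fun e : Fin n →₀ ℕ =>
          Ideal.Quotient.mk (Ideal.span (Set.range (![f] : Fin 1 → MvPolynomial (Fin n) k))) (monomial e (1 : k))) '' (A : Set (Fin n →₀ ℕ)))),
        (HomogeneousIdeal.irrelevant (reesGrading (Ideal.span ((fun e : Fin n →₀ ℕ =>
          Ideal.Quotient.mk (Ideal.span (Set.range (![f] : Fin 1 → MvPolynomial (Fin n) k))) (monomial e (1 : k))) '' (A : Set (Fin n →₀ ℕ)))))).toIdeal ≤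
          (Ideal.span (Set.range fun j : Fin t => reesT (I := Ideal.span ((fun e : Fin n →₀ ℕ =>
            Ideal.Quotient.mk (Ideal.span (Set.range (![f] : Fin 1 → MvPolynomial (Fin n) k))) (monomial e (1 : k))) '' (A : Set (Fin n →₀ ℕ))))
              (v j) (hv j))).radical ∧
        (∀ j : Fin t, v j ≠ 0) ∧
        ∀ (j : Fin t) (Q : Ideal (blowupAlgebra (Ideal.span ((fun e : Fin n →₀ ℕ =>
            Ideal.Quotient.mk (Ideal.span (Set.range (![f] : Fin 1 → MvPolynomial (Fin n) k))) (monomial e (1 : k))) '' (A : Set (Fin n →₀ ℕ))))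
            (v j))) [Q.IsMaximal],
          algebraMap _ (blowupAlgebra (Ideal.span ((fun e : Fin n →₀ ℕ =>
            Ideal.Quotient.mk (Ideal.span (Set.range (![f] : Fin 1 → MvPolynomial (Fin n) k))) (monomial e (1 : k))) '' (A : Set (Fin n →₀ ℕ))))
            (v j)) (v j) ∈ Q →
          ∀ d : ℕ, ringKrullDim (Localization.AtPrime Q) = d → ∀ s : Fin d → Localization.AtPrime Q,
            (Ideal.span (Set.range s)).radical.IsMaximal → RingTheory.Sequence.IsWeaklyRegular (Localization.AtPrime Q) (List.ofFn s) ∧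
            ∀ y : Localization.AtPrime Q, (∃ e : ℕ, y ^ p ^ e ∈ Ideal.span ((fun z : Localization.AtPrime Q => z ^ p ^ e) ''
              (Ideal.span (Set.range s) : Set (Localization.AtPrime Q)))) → y ∈ Ideal.span (Set.range s)) :
    ∃ (t : ℕ) (v : Fin t → MvPolynomial (Fin n) k ⧸ Ideal.span {g})
        (hv : ∀ j : Fin t, v j ∈ Ideal.span ((fun e : Fin n →₀ ℕ =>
          Ideal.Quotient.mk (Ideal.span {g}) (σ (monomial e (1 : k)))) '' (A : Set (Fin n →₀ ℕ)))),
        (HomogeneousIdeal.irrelevant (reesGrading (Ideal.span ((fun e : Fin n →₀ ℕ =>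
          Ideal.Quotient.mk (Ideal.span {g}) (σ (monomial e (1 : k)))) '' (A : Set (Fin n →₀ ℕ)))))).toIdeal ≤
          (Ideal.span (Set.range fun j : Fin t => reesT (I := Ideal.span ((fun e : Fin n →₀ ℕ =>
            Ideal.Quotient.mk (Ideal.span {g}) (σ (monomial e (1 : k)))) '' (A : Set (Fin n →₀ ℕ)))) (v j) (hv j))).radical ∧
        (∀ j : Fin t, v j ≠ 0) ∧
        ∀ (j : Fin t) (Q : Ideal (blowupAlgebra (Ideal.span ((fun e : Fin n →₀ ℕ =>
            Ideal.Quotient.mk (Ideal.span {g}) (σ (monomial e (1 : k)))) '' (A : Set (Fin n →₀ ℕ)))) (v j))) [Q.IsMaximal],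
          algebraMap _ (blowupAlgebra (Ideal.span ((fun e : Fin n →₀ ℕ =>
            Ideal.Quotient.mk (Ideal.span {g}) (σ (monomial e (1 : k)))) '' (A : Set (Fin n →₀ ℕ)))) (v j)) (v j) ∈ Q →
          ∀ d : ℕ, ringKrullDim (Localization.AtPrime Q) = d → ∀ s : Fin d → Localization.AtPrime Q,
            (Ideal.span (Set.range s)).radical.IsMaximal → RingTheory.Sequence.IsWeaklyRegular (Localization.AtPrime Q) (List.ofFn s) ∧
            ∀ y : Localization.AtPrime Q, (∃ e : ℕ, y ^ p ^ e ∈ Ideal.span ((fun z : Localization.AtPrime Q => z ^ p ^ e) ''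
              (Ideal.span (Set.range s) : Set (Localization.AtPrime Q)))) → y ∈ Ideal.span (Set.range s) := by
  obtain ⟨ε, hε⟩ := exists_quotientEquiv_range_of_ringEquiv σ f g hg
  have hmoved := CertifiedCoverCongr.cert_congr p ε _ h
  refine TwoLevelRoadFrame.block_of_eq p ?_ hmoved
  rw [Ideal.map_span, ← Set.image_comp]
  congr 1
  ext y
  simp only [Set.mem_image, Function.comp_apply]
  constructor
  · rintro ⟨i, hi, rfl⟩
    exact ⟨i, hi, (hε _).symm⟩
  · rintro ⟨i, hi, rfl⟩
    exact ⟨i, hi, hε _⟩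

end Summit.ResolutionOfSingularities.ResolutionOfSingularities.Theorems.FInjectiveMacaulayfication.LevelTwoBlockTranslate

end
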